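import Literature.MathematicalPhysics.QuantumFieldTheory.Balaban1983to89.T4MatchingClosure

/-!
# `Balaban1983to89.T4RemnantBooking` — the REMNANT BOOKING under the logarithmic window: the located residual R4 of
row T4-U5.E-b (cell `pub-balaban`, T4-DAG v6 §5 rows T4-U5.E-b / T4-U5.R / T4-U5.E-CLOSE; cell GAPS G-pv06g7-5; kernel
bookkeeping over `T4GoodClassBudget` §3b and `T4MatchingClosure` §5; records `t4/T4-EST-U5E-b-R1.md` v1.1,
`t4/T4-EST-U5E-b.md` v1.2, referee report `t4/T4-REF-U5.md` v1 §0 (0.2), §2 F1–F3; v1.1 of this module = DOCFIX after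
the cross-read certificate `b2b-balaban-adv9/g23/XREAD-T4RemnantBooking.md`, cell GAPS C-adv9-59 / G-adv9-60; v1.2 = the
AGE-CONVENTION wording after record `t4/T4-EST-U5E-rem.md` v1, cell GAPS G-pv25g5-5, + §6 producer-side re-parametrisations,
append-only; record `t4/T4-EST-U5E-b-R1.md` v1.2; v1.2.1 = one DIVERGENCE sentence, D-pv14.14, docstring-only;
v1.2.2 = the Lemma Y pointer to `T4BankAgeYoung`, docstring-only)

HONEST FRAMING (cell `pub-balaban`, T4-DAG PAGE 1).  The cell's T4 target is the existence AND uniqueness of the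
continuum limit of Bałaban's unit-scale averaged loop expectations on a finite torus — strictly beyond ultraviolet
stability ([Balaban1989LargeFieldII] Thm 1 p. 355); it is NOT the Yang–Mills mass gap and NOT the Clay problem.  This
module is KERNEL BOOKKEEPING for ONE located term of the two-run ("hybrid term-by-term") matching design: the
exponentiated large-field REMNANTS produced at a RECENT renormalisation step whose cluster hosts a component CREATED
long before.  NOTHING of Bałaban's estimates is proved here.  What is kernel-checked is real-number arithmetic: with an
AGE CUT `A(K) = ⌈C′·log(K+1)⌉` on top of the log window `jlog(K) = K − ⌈C·log(K+1)⌉` of `T4GoodClassBudget` §3b, (a) an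
OLD-BORN part obeying the cell's unprinted age-resolved bound `≤ E₀·ρ^{A(K)}` per scale-`j` cube (`j` a recent step) is
summable in `K` by TRIVIAL counting once `C′(−log ρ) ≥ ⌈C log Λ⌉ + 3` (§2), and (b) the YOUNG part keeps a two-run rate degraded only
polynomially, `θ^{−N′A(K)} ≤ θ^{−N′}·(K+1)^{⌈N′C′ log θ⁻¹⌉}`, so its window sum is still summable for EVERY `θ < 1`
(§3).  The one cell estimate enters as a HYPOTHESIS SHAPE (`RemnantAgeBound`, labelled NOT PRINTED), never as a fact.
The module imports `T4MatchingClosure` only for the exposed log-window majorant (`windowSum_log_le`,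
`summable_pow_mul_windowSum_log`); mathematically it PRODUCES one summand of that module's `Summable u` / `Summable r`
hypotheses (`hybridNE7_closure`), under the "NE7b-rem" packaging named there.

CITATION HEADER (quotations read by this seat from the rendered pages of the cell's page store
`b2b-balaban-ref1/pages/…`, AS IMAGES; ONE run at ONE lattice spacing throughout — none of it is a two-run statement).
* [Balaban1989LargeFieldII] T. Bałaban, *Large field renormalization. II. Localization, exponentiation, and bounds for
  the R operation*, Commun. Math. Phys. 122 (1989) 355–392: p. 356, p. 378 (the operation `𝐓′_k(X)`), (1.72) p. 379,
  (1.83) p. 385, p. 386 (first case), (1.87)–(1.89) p. 387, (1.90)–(1.92) p. 388, (1.98)–(1.101) p. 390 (with the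
  `c₁`-sentence before (1.98)), (1.103)–(1.104) p. 391.
* [Balaban1989LargeFieldI] T. Bałaban, *Large field renormalization. I. The basic step of the R operation*, Commun.
  Math. Phys. 122 (1989) 175–202: p. 201 (before and in (1.100)), p. 202.

WHAT PRINT DOES (location and shape; the tree's `B16` module quotes (1.72), (1.98)–(1.104) as well).  At the step `k`
at which a first-class large-field component `X` is renormalised, print SUMS its sub-history inside the operation
`𝐓′_k(X)` (p. 378: `𝐓′_k(X) = (1/(2^d d!)) Σ_{{Ω^c_j∩X, Z_j∩X}, r} …`), sums the family of such components inside the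
curly bracket of (1.72) (p. 379: «the sum in the definition (1.71) acts also on the last exponential in (1.72)»), sums
their cluster structure (p. 388: «For the fixed decomposition we resum all the expressions determining the same
components. We obtain the following polymer expansion», (1.90)–(1.91)) and exponentiates (p. 390: «The estimate (1.97)
is sufficient for convergence of the exponentiated cluster expansion, and we have {⋯} = exp ℝ′^{(k)} = exp Σ
ℝ′^{(k)}(X). (1.98)», «The exponentiation (1.98) completes the ℝ-operation.»), the terms meeting the large-field
region becoming new boundary terms `𝐁′^{(k)}(X)` and the rest entering the new action (1.101), «The new large field
region is equal to Z_k ∪ ∪_{i=1}^m Y_i».  [Balaban1989LargeFieldI] announces it on p. 201: «In such a representation it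
is natural to replace the summation over {Ω_j, Λ_j} by summations over the corresponding sequences {Ω^c_j, Z_j}
localized in the components.» and on p. 202: «At first, we have to extract from the expression in the curly bracket {⋯}
the density exp A_k, where A_k is the effective action determined by the assumption that Z_k is the only large field
region. The remaining expression should be localized around the components X_1,…,X_n, represented as a polymer
expansion, and finally exponentiated.»  The printed bounds are AGE-FREE: (1.92) p. 388 carries one factor
`exp(−2(1+β₀)^{−1}p₀(g_k) + 1)` per hosted component `X_{j_h}` whatever its creation scale — it comes from (1.89) p. 387,
`𝐓′_k(X)1 ≤ exp(−2(1+β₀)^{−1}p₀(g_k))`, where the accumulated penalty is discarded in (1.88): «≤ κ_{j+1}(Z) −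
2(1+β₀)^{−1}p₀(g_{j+1}) + O(1)3(100M)^d R^{d+2}_{j+1} ≤ κ_{j+1}(Z)» — and (1.100) p. 390 reads «|ℝ′^{(k)}(X,(𝐔,𝐉))| ≤
exp(−p₀(g_k)) exp(−κd_k(X)). (1.100)».  Hence (i) the renormalised structure is NOT index data of the two-run term sum
— the index after step `k` is the (1.104)-datum p. 391: the region `Z_k` with «Σ_{{Ω^c_j,Z_j}} 𝐓″_k(Z_k)» and the
components `Y_1,…,Y_m` («there are no summations over these domains, they are fixed») — so objection R1 (i) of record
`t4/T4-EST-U5E-b.md` v1, which read this the other way, is WITHDRAWN in v1.1; and (ii) the remnants are R-KIND slices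
living at scale `k` (marginal, coefficient `e^{−p₀(g_k)}`, NO contraction gain; the one-run size input is the tree's
`B16.boundR231_of_ineq1100`), so their size/rate crossover is the intrinsic one of `T4Crossover.crossoverDelta` and only
their MULTIPLICITY is a window question (referee F3: two cuts).

THE RESIDUAL (cell analysis, NOT PRINTED; referee report `t4/T4-REF-U5.md` (0.2)/F2, concurred in by this seat).  In
the two-run comparison a remnant exponentiated at a RECENT step `j` whose cluster hosts a component CREATED at an old
scale `m` responds to the runs' data at every scale of the lifetime `[m, j]` (through `𝐓′_j(X)`'s inner operations and
the terms `V(X~)`, «boundary terms from all the renormalization steps», p. 379), so its rate is `θ^m` — useless for old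
`m`; its size `e^{−p₀(g_j)} ≈ e^{−p₀(g_K)}` per recent step is a FIXED small number, not summable in `K`; and it is not
index data, so no weight prices it.  The cell's named repair is ONE unprinted input, the hypothesis shape
`RemnantAgeBound` below (= "NE7b-rem": the part of the step-`j` remnant family hosting a component of AGE `≥ A` —
`A : ℕ` an ABSTRACT age index, every lemma of this module being convention-neutral (AGE CONVENTION below, v1.2): in
v1.1's EPOCH reading, `A` epochs = (R2)-windows, in each of which that component, being still pending, has undergone at
least one EVENT, a RENEWAL or a MERGER, by the printed window bounds (p. 385 «Thus K ≤ n₀ − j + R_j», p. 386 «hence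
K = R_{j+1} for Z», p. 387 «and that K ≤ K₂ + n₁ + R_{j+1}»; record `t4/T4-EST-U5c.md` (R2), «MERGERS ARE EVENTS») —
windows whose printed length is SIZE- and SCALE-dependent; in the producer's BANK reading (cell GAPS G-pv25g5-5), `A`
banked units of that slack — is `≤ E₀·ρ^A` per scale-`j` cube,
`ρ < 1` the per-EVENT factor of the slack that print RETAINS-BUT-DOES-NOT-USE at a merger ((1.88) p. 387,
`2(1+β₀)^{−1}p₀(g_{j+1}) − O(1)3(100M)^dR^{d+2}_{j+1}` per removed tree endpoint) or gains at a renewal (p. 386 «not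
have a better bound for it, but we have the new factor exp(−p₀(g_j))») — `ρ = e^{−(c_b p̄₀ − E)}`, net of the per-epoch
entropy `E` and with ONE event per (R2)-window, in U5c's parametrisation (record `t4/T4-EST-U5c.md` (R1)/(R2)/(R4));
`ρ = e^{−c_e p̄₀}`, with no entropy constant, in the bank reading (record `t4/T4-EST-U5E-rem.md` §0 (b)/(f)) — print
banks NOTHING in an event-free step: (1.83) p. 385 «κ_{j+1}(Z) = κ_j(Z₀) − O(1)M^dR^{d+1}_{j+1}d′_{j+1}(Z)», a persisting component only
LOSES a little there), OR the index-level packaging Bad′ (a component alive in the window and born more than `A(K)`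
epochs before it makes the term bad; priced on the weight side, `T4MatchingClosure.relWeightBound_of_slotDom_log`).
§2–§4 are the ARITHMETIC of the booking: both lemmas serve the NE7b-rem packaging (`summable_remnantBudget`); the young
lemma alone serves Bad′.  A future NE7b-rem producer must also note that (1.100) is print's bound for the SECOND group
only (domains disjoint from `Z_k~ ∪ ∪Y_i~`); the first group, the new boundary terms `𝐁′^{(k)}(X)`, carries `c₁ = α^{1/3}`
in (1.99) p. 390 («where c₁ = exp(−p₀(g_k)) if X′ does not intersect ∪_{i=1}^m Y_i, and c₁ = α^{1/3} in the remaining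
cases»), not `e^{−p₀(g_k)}`.  Conditions to record (cell GAPS): `C·(−log r) > 1` (weight half, `T4MatchingClosure`),
`C′·(−log ρ) ≥ ⌈C·log Λ⌉ + 3` (old-born remnants, trivially counted: `Λ^{K−j}` scale-`j` cubes per unit final volume,
`Λ = L⁴`, the cell convention of `T4RecentScale.Multiplicity`), none on `θ` (young remnants, as for every rate-only
kind).  NORMALISATION (ONE convention, v1.1): `remOld j A` is PER SCALE-`j` CUBE and the consumer supplies the cube count
`Λ^{K−j}` (`T4MatchingClosureRem.remnantOld`, same `Λ` as the rest of its `ReindexedBudget`); the kernel lemmas are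
uniform in `Λ ≥ 1`, so the referee's per-unit-FINAL-volume accounting (`t4/T4-REF-U5.md` (0.2): size `e^{−p₀(g_j)}` per
unit final volume per recent step) is the instance in which a producer has pre-summed the cubes of a unit final cube
into `remOld` and the consumer sets `Λ := 1` (condition `C′(−log ρ) ≥ 3`) — an instantiation, not a second convention.
AGE CONVENTION (v1.2; cell GAPS G-pv25g5-5, record `t4/T4-EST-U5E-rem.md` v1 §0 (a)–(c), §3, §4 of unit
`b2b-balaban-pv25` gen 5 — a CELL RECORD, under adversarial cross-read when this was written, cited as such and never as
print).  `A : ℕ` in `ageCut` / `RemnantAgeBound` is an ABSTRACT age index and §1–§6 are CONVENTION-NEUTRAL.  Three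
readings were on the table: EPOCH age (v1/v1.1: epochs = (R2)-windows, each with ≥ 1 event), STEP age (lifetime
`≥ N′·A` with a FROZEN `N′` — what the epoch sentence becomes once `N′` is fixed), BANK age (`A = ⌊b(h)/(c_e p̄₀)⌋`,
`b(h) = c_e p̄₀·#events + c_s p̄₀²·Σ_births (d′+1)` the combinatorial bank of the component's sub-history, identical in the
two runs: births (1.81)/(1.82) p. 385, renewals p. 386, merger endpoints (1.87)/(1.88) p. 387; event-free steps (1.83)
bank nothing).  The record's located finding (CONFIRMED, with a quotation-hygiene objection, by the U5 referee's
adversarial cross-read, cell GAPS C-pv06g8-1 / G-pv06g8-1; DISPUTED on the price side by the U5c owner lineage, cell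
DIVERGENCE D-pv14.14, record `t4/T4-EST-U5c.md` v1.5.1 §9: print's credits are scale-LOCAL at the same step as its
windows — p. 386 «not have a better bound for it, but we have the new factor exp(−p₀(g_j))», with (2.7) of
[Balaban1988Convergent] p. 255 as a LOCATION — so that, pairing `p₀(g_s)` with `R_s`, STEP-age OLD = BANK-age OLD
uniformly in `K` and the young-side creep is at most `(log log K)^{r}` through the birth epoch, and none at all if the
birth surplus is banked; NEITHER reading is printed — print sums no histories — and the kernel below serves both): the
printed event-free window is SIZE-dependent (p. 385 «Thus K ≤ n₀ − j + R_j», `n₀ − j ≤ log₂ d′_j(Z)` by the halving of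
p. 384) and SCALE-dependent (`R_j` of the step; along the log window `R_j/R_K` is unbounded as `K → ∞` by the flow
inequality (2.9) of [Balaban1988Convergent] p. 256 — LOCATIONS, nothing of [Balaban1988Convergent] is quoted here), so
with a frozen `N′` AND an infrared-frozen credit `c_e·p̄₀` the OLD gain stops being a power of `K` (event-poor thin
components) and with frozen-length epochs the YOUNG locality fails (one fat birth is epoch-young yet anciently
created); the BANK age serves BOTH halves: OLD — `remOld j A ≤ E₀·ρ^A` for ALL `A`, `ρ = e^{−c_e p̄₀}`, with no
lifetime argument and no entropy constant (record §0 (a)/(b)/(f), §3); YOUNG — a sub-history of bank `< c_e p̄₀·A` is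
CREATED within `W(K) = A(K)·N′_K(A(K))` steps of `j`, an allowance creeping poly-logarithmically in `K` (record §4,
Lemma Y — cell analysis, NOT PRINTED; v1.2.2: its ARITHMETIC SKELETON — steps (1), (2c), (3), (4), (5) and remark (Y3)
of the record's §4 — is kernel-checked over hypothesis shapes in `T4BankAgeYoung` (unit `b2b-balaban-pv25` gen 6,
p182815: `lifetime_lt`, `lifetime_lt_flow`, `lifetime_lt_youngWindow`, `polylogWindow_of_le_young`), which hands the
allowance to the consumer's `T4MatchingClosureRem.PolylogWindow` / `SublinearWindow` BY NAME; the geometric and located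
inputs of Lemma Y stay binders there and nothing printed is asserted).  Kernel consequences: none for §1/§2/§4/§5
(`pow_ageCut_le`, `summable_remnantOld_logWindow`, `exists_ageCutConst` serve the bank reading as they stand); the young
lemma `summable_remnantYoung_logWindow` (frozen `N′` — adequate as typed under the D-pv14.14 scale-local reading) is
the exponent-1 instance of the consumer's general statement `T4MatchingClosureRem.summable_remnantYoungW` (unit
`b2b-balaban-pv02` gen 8: ANY sub-linear allowance `W`, `SublinearWindow` / `PolylogWindow` — the insurance the
infrared-frozen reading needs), which is the form a bank-age producer meets; §6 (v1.2, append-only) adds the two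
re-parametrisations such a producer is likely to deliver — a bound `E₀·e^{−c·A}` at bank threshold `c·A`
(`remnantAgeBound_of_exp_neg_mul`, with the old-born condition read `⌈C·log Λ⌉ + 3 ≤ C′·c`,
`summable_remnantOld_logWindow_bank`) and a bound `E₀·ρ^(A−1)` («`A` epochs carry `≥ A − 1` events», record §7 (1))
(`remnantAgeBound_of_pow_pred`) — and the monotonicity of the shape in `E₀` and `ρ`.
Unit `b2b-balaban-pv16` gen 6 (journal CLAIM T4-U5.E-b-R1* 2026-08-19T00:15:45Z); v1.1 = gen 7 DOCFIX (journal CLAIM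
T4-U5.E-b-R1-DOCFIX* 2026-08-19T00:59:55Z) after the cross-read of unit `b2b-balaban-adv9` gen 23 (cell GAPS C-adv9-59 /
G-adv9-60: «per-event-free-epoch factor» / «event-free epochs» corrected to per-EVENT banking with one event per epoch
by (R2); the `𝐁′`-group `c₁ = α^{1/3}` remark; one normalisation stated) — DOCSTRING-ONLY, every `def`/`theorem` is
byte-identical to v1 (p181634); pages p. 385/386/387/390 re-read by the gen-7 seat on the renders as images; v1.2 =
gen 7 (journal CLAIM T4-U5.E-b-R1-CONV* 2026-08-19T01:09:32Z): the AGE CONVENTION paragraph, the `ageCut` /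
`RemnantAgeBound` / young-lemma docstrings and §6 (append-only) after record `t4/T4-EST-U5E-rem.md` v1 (cell GAPS
G-pv25g5-5); the §1–§5 declarations are byte-identical to v1.1 (p181892); v1.2.1 = DOCSTRING-ONLY: the D-pv14.14 /
C-pv06g8-1 sentence of the AGE CONVENTION paragraph (every declaration byte-identical to v1.2, p181980); v1.2.2 =
DOCSTRING-ONLY (unit `b2b-balaban-pv16` gen 10): the Lemma Y pointer of the AGE CONVENTION paragraph to `T4BankAgeYoung`
(p182815), replacing the dated «proved nowhere in the tree» (every declaration byte-identical to v1.2.1, p182002).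
[folklore arithmetic]
-/

open Finset _root_.Filter _root_.Topology

namespace Literature.MathematicalPhysics.QuantumFieldTheory.Balaban1983to89.T4RemnantBooking

open T4CauchySum T4GoodClassBudget T4MatchingClosure

/-! ## §1 The age cut and the hypothesis shape -/

section Shape

/-- The AGE CUT `A(K) = ⌈C′·log(K+1)⌉` — a threshold for the ABSTRACT age index of `RemnantAgeBound` (header, AGE
CONVENTION, v1.2): BANK units `c_e·p̄₀` of printed slack in the producer's reading of cell GAPS G-pv25g5-5; EPOCHS =
(R2)-windows — a component still pending at the end of one has undergone at least one EVENT, a renewal or a merger,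
within it, by the printed window bounds read in record `t4/T4-EST-U5c.md` (R2) — in v1.1's reading, cell GAPS
G-adv9-60. [folklore] -/
noncomputable def ageCut (C' : ℝ) (K : ℕ) : ℕ := ⌈C' * Real.log ((K : ℝ) + 1)⌉₊

/-- `ρ^{A(K)} ≤ (K+1)^{−C′(−log ρ)}` for `0 < ρ ≤ 1`: a geometric gain per epoch over logarithmically many epochs is a
POLYNOMIAL gain in `K`. [folklore] -/
theorem pow_ageCut_le {ρ : ℝ} (h0 : 0 < ρ) (h1 : ρ ≤ 1) (C' : ℝ) (K : ℕ) :
    ρ ^ ageCut C' K ≤ ((K : ℝ) + 1) ^ (-(C' * (-Real.log ρ))) := by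
  unfold ageCut
  have e : -(C' * (-Real.log ρ)) = C' * Real.log ρ := by ring
  rw [e, ← rpow_log_swap h0 C' K, ← Real.rpow_natCast ρ ⌈C' * Real.log ((K : ℝ) + 1)⌉₊]
  exact Real.rpow_le_rpow_of_exponent_ge h0 h1 (Nat.le_ceil _)

/-- The age allowance costs a POLYNOMIAL: `θ^{−N′A(K)} ≤ θ^{−N′}·(K+1)^{⌈N′C′·log θ⁻¹⌉}` for `0 < θ < 1`, `C′ ≥ 0`.
[folklore] -/
theorem inv_pow_ageCut_le {θ C' : ℝ} (N' : ℕ) (hθ : 0 < θ) (hθ1 : θ < 1) (hC' : 0 ≤ C') (K : ℕ) :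
    θ⁻¹ ^ (N' * ageCut C' K) ≤ θ⁻¹ ^ N' * ((K : ℝ) + 1) ^ ⌈(N' : ℝ) * C' * Real.log θ⁻¹⌉₊ := by
  have hι : 1 ≤ θ⁻¹ := (one_le_inv₀ hθ).2 hθ1.le
  have hι0 : 0 < θ⁻¹ := inv_pos.2 hθ
  have hK0 : (0 : ℝ) ≤ (K : ℝ) := Nat.cast_nonneg K
  have hK1 : (1 : ℝ) ≤ (K : ℝ) + 1 := by linarith
  have hx : 0 ≤ C' * Real.log ((K : ℝ) + 1) := mul_nonneg hC' (Real.log_nonneg hK1)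
  have h1 : ((N' * ageCut C' K : ℕ) : ℝ) ≤ (N' : ℝ) * (C' * Real.log ((K : ℝ) + 1)) + N' := by
    have hc : ((ageCut C' K : ℕ) : ℝ) ≤ C' * Real.log ((K : ℝ) + 1) + 1 := (Nat.ceil_lt_add_one hx).le
    have hN : (0 : ℝ) ≤ (N' : ℝ) := Nat.cast_nonneg N'
    have := mul_le_mul_of_nonneg_left hc hN
    rw [mul_add, mul_one] at this
    push_cast
    linarith
  have hp : ((K : ℝ) + 1) ^ ((N' : ℝ) * C' * Real.log θ⁻¹) ≤ ((K : ℝ) + 1) ^ ⌈(N' : ℝ) * C' * Real.log θ⁻¹⌉₊ := by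
    calc ((K : ℝ) + 1) ^ ((N' : ℝ) * C' * Real.log θ⁻¹)
        ≤ ((K : ℝ) + 1) ^ ((⌈(N' : ℝ) * C' * Real.log θ⁻¹⌉₊ : ℕ) : ℝ) :=
          Real.rpow_le_rpow_of_exponent_le hK1 (Nat.le_ceil _)
      _ = ((K : ℝ) + 1) ^ ⌈(N' : ℝ) * C' * Real.log θ⁻¹⌉₊ := Real.rpow_natCast _ _
  calc θ⁻¹ ^ (N' * ageCut C' K) = θ⁻¹ ^ (((N' * ageCut C' K : ℕ) : ℝ)) := (Real.rpow_natCast _ _).symm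
    _ ≤ θ⁻¹ ^ ((N' : ℝ) * (C' * Real.log ((K : ℝ) + 1)) + N') := Real.rpow_le_rpow_of_exponent_le hι h1
    _ = θ⁻¹ ^ ((N' : ℝ) * C' * Real.log ((K : ℝ) + 1)) * θ⁻¹ ^ ((N' : ℕ) : ℝ) := by
        rw [← Real.rpow_add hι0]; congr 1; ring
    _ = θ⁻¹ ^ N' * ((K : ℝ) + 1) ^ ((N' : ℝ) * C' * Real.log θ⁻¹) := by
        rw [rpow_log_swap hι0 ((N' : ℝ) * C') K, Real.rpow_natCast, mul_comm]
    _ ≤ θ⁻¹ ^ N' * ((K : ℝ) + 1) ^ ⌈(N' : ℝ) * C' * Real.log θ⁻¹⌉₊ :=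
        mul_le_mul_of_nonneg_left hp (pow_nonneg hι0.le _)

/-- HYPOTHESIS SHAPE `RemnantAgeBound` (cell "NE7b-rem", referee report `t4/T4-REF-U5.md` (0.2)/F2; NOT PRINTED —
print's (1.92) p. 388 and (1.100) p. 390 are the age-free case `A = 0`): `remOld j A` — PER SCALE-`j` CUBE `□` (the ONE
normalisation of this shape, v1.1: the consumer supplies the count `Λ^{K−j}` of scale-`j` cubes per unit final volume,
`Λ = L⁴` as in `T4RecentScale.Multiplicity`; a producer who has pre-summed the cubes of a unit final cube files the same
shape and the consumer instantiates `Λ := 1`), the two-run discrepancy (at most twice the one-run size) of the part of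
the step-`j` remnant family `Σ_{X ∋ □} |ℝ′^{(j)}(X)|` whose cluster hosts a large-field component of AGE at least `A` —
`A : ℕ` an ABSTRACT index (header, AGE CONVENTION, v1.2): in the producer's BANK reading (cell GAPS G-pv25g5-5, record
`t4/T4-EST-U5E-rem.md` §0 (a)–(c)) the component's sub-history has banked at least `A` units `c_e·p̄₀` of printed slack
(births (1.81)/(1.82) p. 385, renewals p. 386, merger endpoints (1.88) p. 387; event-free steps bank nothing) and the
bound holds for ALL `A` with `ρ = e^{−c_e p̄₀}`; in v1.1's EPOCH reading it has been pending for `A` (R2)-windows (hence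
with at least `A` EVENTS — renewals or mergers — in its history, one per window by the printed window bounds, record
`t4/T4-EST-U5c.md` (R2); the printed window length is size- and scale-dependent, so with a frozen `N′` this is the step
reading, which the record shows to fail as `K → ∞`) — satisfies `0 ≤ remOld j A ≤ E₀·ρ^A`, with `E₀` absorbing
`e^{−p₀(g_j)} ≤ 1` and `Σ_{X ∋ □} e^{−κd_j(X)}`, and `ρ < 1` the per-EVENT factor (banked slack per merger endpoint (1.88)
p. 387 / per renewal p. 386; `e^{−(c_b p̄₀ − E)}` net of the per-epoch entropy `E` in U5c's parametrisation, record
`t4/T4-EST-U5c.md` (R1)/(R4); `e^{−c_e p̄₀}` in the bank reading) — NOT a per-event-free-step factor: print's event-free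
step (1.83) p. 385 banks nothing (v1 said «event-free epochs»; corrected after cell GAPS G-adv9-60).  Nothing about it
is proved here. [folklore]
(a definition; the bound is cell NE7b-rem, NOT PRINTED) -/
def RemnantAgeBound (remOld : ℕ → ℕ → ℝ) (E₀ ρ : ℝ) : Prop :=
  ∀ j A : ℕ, 0 ≤ remOld j A ∧ remOld j A ≤ E₀ * ρ ^ A

end Shape

/-! ## §2 Old-born remnants: a polynomially small discrepancy, trivially counted on a polynomial window -/

section Old

/-- OLD-BORN REMNANTS, TRIVIALLY COUNTED ON THE LOG WINDOW, ARE SUMMABLE once `C′(−log ρ) ≥ ⌈C log Λ⌉ + 3`: per unit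
volume the recent steps `jlog(K) ≤ j ≤ K` contribute `Σ_j Λ^{K−j}·remOld j A(K) ≤ E₀ρ^{A(K)}·Σ_j Λ^{K−j}`, a
polynomially small discrepancy (`pow_ageCut_le`) times a polynomial count (`T4GoodClassBudget.windowCount_log_le`,
through `summable_polyRate_logWindow`).  The statement is uniform in `Λ ≥ 1`; instantiated at `Λ := 1` (a producer
who has pre-summed the scale-`j` cubes of a unit final cube into `remOld` — the referee's accounting per unit FINAL
volume, `t4/T4-REF-U5.md` (0.2)) the condition reads `C′(−log ρ) ≥ 3`.  The normalisation of `RemnantAgeBound` itself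
is per scale-`j` cube (v1.1, one convention). [folklore] -/
theorem summable_remnantOld_logWindow {Λ C C' E₀ ρ : ℝ} {remOld : ℕ → ℕ → ℝ} (hΛ : 1 ≤ Λ) (hC : 0 ≤ C)
    (hE : 0 ≤ E₀) (h0 : 0 < ρ) (h1 : ρ < 1) (h : RemnantAgeBound remOld E₀ ρ)
    (hq : ((⌈C * Real.log Λ⌉₊ : ℕ) : ℝ) + 3 ≤ C' * (-Real.log ρ)) :
    Summable (fun K => ∑ j ∈ Icc (jlogOf C K) K, Λ ^ (K - j) * remOld j (ageCut C' K)) := by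
  have hΛ0 : 0 < Λ := lt_of_lt_of_le one_pos hΛ
  have hd0 : ∀ K, 0 ≤ E₀ * ρ ^ ageCut C' K := fun K => mul_nonneg hE (pow_nonneg h0.le _)
  have hd : ∀ K, E₀ * ρ ^ ageCut C' K ≤ E₀ * ((K : ℝ) + 1) ^ (-(C' * (-Real.log ρ))) :=
    fun K => mul_le_mul_of_nonneg_left (pow_ageCut_le h0 h1.le C' K) hE
  have hmaj := summable_polyRate_logWindow hΛ hC hE hd0 hd hq
  refine Summable.of_nonneg_of_le (fun K => Finset.sum_nonneg fun j _ =>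
    mul_nonneg (pow_nonneg hΛ0.le _) (h j _).1) (fun K => ?_) hmaj
  show ∑ j ∈ Icc (jlogOf C K) K, Λ ^ (K - j) * remOld j (ageCut C' K) ≤
    E₀ * ρ ^ ageCut C' K * ∑ j ∈ Icc (jlogOf C K) K, (1 : ℝ) ^ j * Λ ^ (K - j)
  rw [Finset.mul_sum]
  refine Finset.sum_le_sum fun j _ => ?_
  calc Λ ^ (K - j) * remOld j (ageCut C' K) ≤ Λ ^ (K - j) * (E₀ * ρ ^ ageCut C' K) :=
        mul_le_mul_of_nonneg_left (h j _).2 (pow_nonneg hΛ0.le _)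
    _ = E₀ * ρ ^ ageCut C' K * ((1 : ℝ) ^ j * Λ ^ (K - j)) := by rw [one_pow, one_mul]; ring

end Old

/-! ## §3 Young remnants: a rate degraded by a polynomial is still summable on the log window -/

section Young

/-- YOUNG REMNANTS KEEP A RATE, UP TO A POLYNOMIAL: with the age allowance of `A(K)` epochs of `N′` steps the rate
`θ^{j − N′A(K)}` costs the factor `θ^{−N′A(K)} ≤ θ^{−N′}·(K+1)^{⌈N′C′·log θ⁻¹⌉}` (`inv_pow_ageCut_le`), and the
log-window θ-sum stays summable for EVERY `θ < 1` (`T4MatchingClosure.summable_pow_mul_windowSum_log`).  Frozen `N′`: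
the exponent-1 (no-creep) instance of the consumer's general statement `T4MatchingClosureRem.summable_remnantYoungW` (ANY
sub-linear allowance `W(K)`; unit `b2b-balaban-pv02` gen 8), which is the form a bank-age producer meets (header, AGE
CONVENTION, v1.2). [folklore] -/
theorem summable_remnantYoung_logWindow {θ Λ C C' : ℝ} (N' : ℕ) (hθ : 0 < θ) (hθ1 : θ < 1) (hΛ : 1 ≤ Λ)
    (hC : 0 ≤ C) (hC' : 0 ≤ C') :
    Summable (fun K : ℕ => θ⁻¹ ^ (N' * ageCut C' K) * windowSum θ Λ (jlogOf C K) K) := by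
  have hΛ0 : 0 < Λ := lt_of_lt_of_le one_pos hΛ
  have hι0 : 0 < θ⁻¹ := inv_pos.2 hθ
  have hmaj := (summable_pow_mul_windowSum_log hθ hθ1 hΛ hC ⌈(N' : ℝ) * C' * Real.log θ⁻¹⌉₊).mul_left (θ⁻¹ ^ N')
  refine Summable.of_nonneg_of_le (fun K => mul_nonneg (pow_nonneg hι0.le _) (windowSum_nonneg hθ.le hΛ0.le _ _))
    (fun K => ?_) hmaj
  calc θ⁻¹ ^ (N' * ageCut C' K) * windowSum θ Λ (jlogOf C K) K
      ≤ (θ⁻¹ ^ N' * ((K : ℝ) + 1) ^ ⌈(N' : ℝ) * C' * Real.log θ⁻¹⌉₊) * windowSum θ Λ (jlogOf C K) K :=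
        mul_le_mul_of_nonneg_right (inv_pow_ageCut_le N' hθ hθ1 hC' K) (windowSum_nonneg hθ.le hΛ0.le _ _)
    _ = θ⁻¹ ^ N' * (((K : ℝ) + 1) ^ ⌈(N' : ℝ) * C' * Real.log θ⁻¹⌉₊ * windowSum θ Λ (jlogOf C K) K) :=
        mul_assoc _ _ _

end Young

/-! ## §4 The remnant budget (NE7b-rem packaging) and where it plugs -/

section Budget

/-- THE REMNANT BUDGET under the NE7b-rem packaging: old-born part plus young part (times the kind constant `C_y` of the
young rate) is summable in `K` — one summand of the `Summable u` (or `Summable r`) hypothesis of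
`T4MatchingClosure.hybridNE7_closure` for the remnant slices (`ReindexedBudget.uv_radius` / `recent_remainder`).  Under
the Bad′ packaging only the young summand is used and the old-born components are priced by
`T4MatchingClosure.relWeightBound_of_slotDom_log`. [folklore] -/
theorem summable_remnantBudget {θ Λ C C' E₀ ρ Cy : ℝ} {N' : ℕ} {remOld : ℕ → ℕ → ℝ} (hθ : 0 < θ) (hθ1 : θ < 1)
    (hΛ : 1 ≤ Λ) (hC : 0 ≤ C) (hC' : 0 ≤ C') (hE : 0 ≤ E₀) (h0 : 0 < ρ) (h1 : ρ < 1)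
    (h : RemnantAgeBound remOld E₀ ρ) (hq : ((⌈C * Real.log Λ⌉₊ : ℕ) : ℝ) + 3 ≤ C' * (-Real.log ρ)) :
    Summable (fun K => (∑ j ∈ Icc (jlogOf C K) K, Λ ^ (K - j) * remOld j (ageCut C' K)) +
      Cy * (θ⁻¹ ^ (N' * ageCut C' K) * windowSum θ Λ (jlogOf C K) K)) :=
  (summable_remnantOld_logWindow hΛ hC hE h0 h1 h hq).add
    ((summable_remnantYoung_logWindow N' hθ hθ1 hΛ hC hC').mul_left Cy)

/-- THE AGE-CUT CONSTANT EXISTS: for `0 < ρ < 1` and any `C, Λ` there is `C′ ≥ 0` with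
`⌈C log Λ⌉ + 3 ≤ C′(−log ρ)` (take `C′ = (⌈C log Λ⌉ + 3)/(−log ρ)`). [folklore] -/
theorem exists_ageCutConst {ρ : ℝ} (h0 : 0 < ρ) (h1 : ρ < 1) (C Λ : ℝ) :
    ∃ C' : ℝ, 0 ≤ C' ∧ ((⌈C * Real.log Λ⌉₊ : ℕ) : ℝ) + 3 ≤ C' * (-Real.log ρ) := by
  have hl : 0 < -Real.log ρ := by have := Real.log_neg h0 h1; linarith
  refine ⟨(((⌈C * Real.log Λ⌉₊ : ℕ) : ℝ) + 3) / (-Real.log ρ), div_nonneg (by positivity) hl.le, ?_⟩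
  rw [div_mul_cancel₀ _ hl.ne']

end Budget

/-! ## §5 Sanity: the shape is inhabited and the lemmas fire on it -/

section Sanity

/-- SANITY (non-vacuity of `RemnantAgeBound`): the saturating profile `remOld j A := E₀·ρ^A` satisfies the shape for
`E₀ ≥ 0`, `ρ ≥ 0`. [folklore] -/
theorem remnantAgeBound_saturated {E₀ ρ : ℝ} (hE : 0 ≤ E₀) (hρ : 0 ≤ ρ) :
    RemnantAgeBound (fun _ A => E₀ * ρ ^ A) E₀ ρ :=
  fun _ _ => ⟨mul_nonneg hE (pow_nonneg hρ _), le_rfl⟩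

/-- SANITY (the budget lemma fires on the saturating profile): with `θ = ρ = 1/2`, `Λ = C = E₀ = C_y = N′ = 1` and
the age-cut constant from `exists_ageCutConst`, the remnant budget is summable. [folklore] -/
example : ∃ C' : ℝ, Summable (fun K => (∑ j ∈ Icc (jlogOf 1 K) K,
      (1 : ℝ) ^ (K - j) * ((1 : ℝ) * (1 / 2 : ℝ) ^ ageCut C' K)) +
    1 * ((1 / 2 : ℝ)⁻¹ ^ (1 * ageCut C' K) * windowSum (1 / 2) 1 (jlogOf 1 K) K)) := by
  obtain ⟨C', hC', hq⟩ := exists_ageCutConst (ρ := (1 / 2 : ℝ)) (by norm_num) (by norm_num) 1 1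
  exact ⟨C', summable_remnantBudget (θ := 1 / 2) (Λ := 1) (C := 1) (E₀ := 1) (ρ := 1 / 2) (Cy := 1) (N' := 1)
    (remOld := fun _ A => (1 : ℝ) * (1 / 2 : ℝ) ^ A) (by norm_num) (by norm_num) le_rfl zero_le_one hC' zero_le_one
    (by norm_num) (by norm_num) (remnantAgeBound_saturated zero_le_one (by norm_num)) hq⟩

end Sanity

/-! ## §6 Producer-side re-parametrisations of the shape (v1.2, append-only; cell GAPS G-pv25g5-5)

A producer of NE7b-rem in the BANK reading (record `t4/T4-EST-U5E-rem.md` §0 (a)/(b) — a cell record, NOT PRINTED, not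
proved here) naturally delivers `remOld j A ≤ E₀·e^{−c·A}` (`c = c_e·p̄₀ > 0`, bank threshold `B = c·A`), or — counting
epochs — `E₀·ρ^(A−1)` («`A` epochs carry at least `A − 1` events», record §7 (1)).  Both ARE the shape `RemnantAgeBound`
after an elementary re-parametrisation, and the old-born condition of §2 then reads `⌈C·log Λ⌉ + 3 ≤ C′·c`, met by CHOOSING
`C′` (`exists_ageCutConst`).  Real-number bookkeeping only. [folklore] -/

section Reparam

/-- `0 < e^{−c} < 1` for `c > 0` (the rate of the bank form). [folklore] -/
theorem exp_neg_pos_lt_one {c : ℝ} (hc : 0 < c) : 0 < Real.exp (-c) ∧ Real.exp (-c) < 1 :=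
  ⟨Real.exp_pos _, Real.exp_lt_one_iff.2 (by linarith)⟩

/-- BANK FORM ⇒ SHAPE: a bound `remOld j A ≤ E₀·exp(−c·A)` at bank threshold `c·A` IS `RemnantAgeBound remOld E₀ (exp(−c))`
(`exp(−c·A) = (exp(−c))^A`). [folklore] -/
theorem remnantAgeBound_of_exp_neg_mul {remOld : ℕ → ℕ → ℝ} {E₀ c : ℝ}
    (h : ∀ j A : ℕ, 0 ≤ remOld j A ∧ remOld j A ≤ E₀ * Real.exp (-(c * A))) :
    RemnantAgeBound remOld E₀ (Real.exp (-c)) := by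
  intro j A
  obtain ⟨h0, h1⟩ := h j A
  refine ⟨h0, ?_⟩
  have e : Real.exp (-(c * (A : ℝ))) = Real.exp (-c) ^ A := by
    rw [← Real.exp_nat_mul]; congr 1; ring
  rwa [e] at h1

/-- THE OLD-BORN BOOKING IN BANK FORM (record §0 (b)): with a producer bound `E₀·e^{−c·A}`, `c > 0`, the condition of
`summable_remnantOld_logWindow` reads `⌈C·log Λ⌉₊ + 3 ≤ C′·c` (since `−log e^{−c} = c`). [folklore] -/
theorem summable_remnantOld_logWindow_bank {Λ C C' E₀ c : ℝ} {remOld : ℕ → ℕ → ℝ} (hΛ : 1 ≤ Λ) (hC : 0 ≤ C)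
    (hE : 0 ≤ E₀) (hc : 0 < c) (h : ∀ j A : ℕ, 0 ≤ remOld j A ∧ remOld j A ≤ E₀ * Real.exp (-(c * A)))
    (hq : ((⌈C * Real.log Λ⌉₊ : ℕ) : ℝ) + 3 ≤ C' * c) :
    Summable (fun K => ∑ j ∈ Icc (jlogOf C K) K, Λ ^ (K - j) * remOld j (ageCut C' K)) :=
  summable_remnantOld_logWindow hΛ hC hE (exp_neg_pos_lt_one hc).1 (exp_neg_pos_lt_one hc).2
    (remnantAgeBound_of_exp_neg_mul h) (by rwa [Real.log_exp, neg_neg])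

/-- «`A` EPOCHS CARRY `≥ A − 1` EVENTS» ⇒ SHAPE: a bound `remOld j A ≤ E₀·ρ^(A−1)` (natural-number `A − 1`) with `0 ≤ E₀`,
`0 < ρ ≤ 1` IS `RemnantAgeBound remOld (E₀/ρ) ρ` — one factor `ρ⁻¹` moves into the constant. [folklore] -/
theorem remnantAgeBound_of_pow_pred {remOld : ℕ → ℕ → ℝ} {E₀ ρ : ℝ} (hE : 0 ≤ E₀) (hρ : 0 < ρ) (hρ1 : ρ ≤ 1)
    (h : ∀ j A : ℕ, 0 ≤ remOld j A ∧ remOld j A ≤ E₀ * ρ ^ (A - 1)) :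
    RemnantAgeBound remOld (E₀ / ρ) ρ := by
  intro j A
  obtain ⟨h0, h1⟩ := h j A
  refine ⟨h0, h1.trans ?_⟩
  cases A with
  | zero =>
    have hm : E₀ * ρ ≤ E₀ := by nlinarith
    simpa using (le_div_iff₀ hρ).2 hm
  | succ n =>
    have e : E₀ / ρ * ρ ^ (n + 1) = E₀ * ρ ^ n := by
      rw [pow_succ', ← mul_assoc, div_mul_cancel₀ E₀ hρ.ne']
    simp [e]

/-- The shape is MONOTONE in the constant `E₀` (for `ρ ≥ 0`). [folklore] -/
theorem RemnantAgeBound.mono {remOld : ℕ → ℕ → ℝ} {E₀ E₀' ρ : ℝ} (h : RemnantAgeBound remOld E₀ ρ) (hρ : 0 ≤ ρ)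
    (hE : E₀ ≤ E₀') : RemnantAgeBound remOld E₀' ρ :=
  fun j A => ⟨(h j A).1, (h j A).2.trans (mul_le_mul_of_nonneg_right hE (pow_nonneg hρ _))⟩

/-- The shape is MONOTONE in the rate `ρ` (for `E₀ ≥ 0`, `0 ≤ ρ ≤ ρ′`): a producer may always report a worse rate.
[folklore] -/
theorem RemnantAgeBound.mono_rate {remOld : ℕ → ℕ → ℝ} {E₀ ρ ρ' : ℝ} (h : RemnantAgeBound remOld E₀ ρ) (hE : 0 ≤ E₀)
    (hρ : 0 ≤ ρ) (hρρ : ρ ≤ ρ') : RemnantAgeBound remOld E₀ ρ' :=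
  fun j A => ⟨(h j A).1, (h j A).2.trans (mul_le_mul_of_nonneg_left (pow_le_pow_left₀ hρ hρρ A) hE)⟩

/-- SANITY (§6 fires): the bank-form profile `remOld j A := e^{−2A}` books on the log window with `Λ = C = 1`, `C′ = 3/2`
(condition `⌈0⌉ + 3 ≤ (3/2)·2`). [folklore] -/
example : Summable (fun K => ∑ j ∈ Icc (jlogOf 1 K) K,
    (1 : ℝ) ^ (K - j) * Real.exp (-(2 * (ageCut (3 / 2) K : ℝ)))) := by
  refine summable_remnantOld_logWindow_bank (Λ := 1) (C := 1) (C' := 3 / 2) (E₀ := 1) (c := 2)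
    (remOld := fun _ A => Real.exp (-(2 * (A : ℝ)))) le_rfl zero_le_one zero_le_one two_pos
    (fun _ A => ⟨(Real.exp_pos _).le, by rw [one_mul]⟩) ?_
  norm_num

end Reparam

end Literature.MathematicalPhysics.QuantumFieldTheory.Balaban1983to89.T4RemnantBooking
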